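import Literature.MathematicalPhysics.QuantumLattice.SpinTwistedHubbardTorus
import Literature.MathematicalPhysics.QuantumLattice.ReducedBCSTorus
import Literature.MathematicalPhysics.QuantumLattice.DWaveSourceParticleHole
import Literature.MathematicalPhysics.QuantumLattice.FermionGammaFunctor
import HarnessLib

/-!
# Bogoliubov–de Gennes data of the `U = 0` spin-twisted, `d`-wave-sourced torus

Topic `Literature/MathematicalPhysics/QuantumLattice` (family `hubbard`), companion of
`SpinTwistedHubbardTorus.lean` (the boost-gauge spin-twisted torus `H_L(U,φ)` and its sourced
grand-canonical family `sourcedSpinTwistedHubbardTorus L U μ₀ h φ = H_L(U,φ) - μ₀N - h(P_φ + P_φᴴ)`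
of route `HubbardSuperconductivity/NodalDiracTwist`). This file fixes the VOCABULARY of the exact
solution of that family at `U = 0` (a quadratic, `U(1)`-breaking fermion Hamiltonian), in the
tree's conventions (`latticeMomentum`, `planeWave`, `torusFourierWeight`, `momentumAnnihilation`,
`partialParticleHole`, `Gamma`); the diagonalisation itself is proved in the consumer files.

* Symbols at momentum `k ∈ (ℤ/Lℤ)^d` and twist `φ`: the twisted bands
  `twistHopSymbol L φ k σ = 2 Σ_μ cos(p_μ + (-1)^σ φ_μ/L)` (`p = 2πk/L`), the consistently twisted
  `d`-wave pair symbol `twistPairSymbol L φ k = 2 Σ_μ (-1)^μ cos(p_μ + φ_μ/L)`, the level energy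
  `twistXi L μ₀ φ k = -2 Σ_μ cos(p_μ + φ_μ/L) - μ₀` and the Nambu symbol
  `twistNambuZ L μ₀ h φ k = ξ_k + i h ĝ_k ∈ ℂ` (the Nambu block is `[[ξ, hĝ], [hĝ, -ξ]]`, energies
  `±|z_k|`).
* `nambuQuad L k a b = a(n_{k↑} - n_{k↓}) + b(c†_{k↓}c_{k↑} + c†_{k↑}c_{k↓})`, the second quantisation
  of `[[a, b], [b, -a]]` on the Bloch modes `(k↑), (k↓)` (the Nambu block that the pairing block
  `(k↑, -k↓)` becomes after Lieb's partial particle–hole transformation `c_{x↓} ↦ c†_{x↓}`).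
* Real `2 × 2` eigenvectors encoded as complex numbers `p = x + iy ↔ (x, y)`: `[[a,b],[b,-a]]` acts
  as `p ↦ z p̄` (`z = a + ib`), so `nambuLower z = i√z/|√z|` is the unit eigenvector of eigenvalue
  `-|z|` and `-i · nambuLower z = √z/|√z|` that of `+|z|`; `nambuMode L k p` is the one-particle mode
  `L^{-d/2}(x χ_k ⊗ ↑ + y χ_k ⊗ ↓)`.
* `bdgSpinor`, `bdgModeMatrix L μ₀ h φ` (the one-body unitary whose column at the orbital label
  `(x, σ)` is the Bogoliubov mode of momentum `x̄` in the upper (`σ = 0`) / lower (`σ = 1`) band),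
  `bdgModeEnergy` (`±|z_{x̄}|`), and the many-body diagonalising unitary
  `bdgV L μ₀ h φ = Γ(U)ᴴ W` (`W = partialParticleHole D↓`).

Proved here (small API only): `twistXi_eq`, `norm_nambuLower`, `norm_mul_nambuLower_sq`
(`|z| p₋² = -z`, from Mathlib's `Complex.cpow_ofNat_inv_pow`), `bdgModeMatrix_col`. Everything else (momentum-space form, `W H Wᴴ = Σ_k Q_k`,
`Q_k = |z_k|(n(u₊) - n(u₋))`, unitarity, `H = Vᴴ (Σ e n + C) V`, `ker S^z ↔` half filling) is
proved in the consumer files. No named facts.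

## Sources

P. G. de Gennes, *Superconductivity of Metals and Alloys* (Benjamin, 1966), Ch. 5 (BdG equations,
Nambu form, Bogoliubov angles); E. H. Lieb, PRL 62 (1989) 1201, proof of Thm 2 (partial
particle–hole transformation); V. Bach, E. H. Lieb, J. P. Solovej, J. Stat. Phys. 76 (1994) 3, §2;
S. Karakuzu, K. Seki, S. Sorella, PRB 98 (2018) 075156, Sec. II D (opposite spin twists). All
definitions are textbook (folklore).

## Mathlib / tree search

`lean search 'twistHopSymbol|nambuQuad|nambuLower|bdgModeMatrix|BdG.*mode'`: nothing. REUSED: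
`latticeMomentum`, `planeWave`, `torusFourierWeight`, `momentumAnnihilation/Creation/Number`
(`ReducedBCSTorus`), `partialParticleHole`, `spinDownOrbitals`, `Gamma`. Mathlib: principal power
`z ^ (2⁻¹ : ℂ)` (`Complex.cpow_ofNat_inv_pow`; the tree's `SlitDisc.cpow_two_inv_sq`,
`norm_cpow_half_sq` restate it and are not re-declared here).
-/

noncomputable section

namespace Literature.MathematicalPhysics.QuantumLattice

open Matrix Finset Literature.Probability.LatticeModels
open scoped ComplexConjugate

variable {d : ℕ} (L : ℕ)

/-! ### Twisted symbols -/

/-- The twisted band of spin `σ`: `t_σ(k, φ) = 2 Σ_μ cos(2πk_μ/L + (-1)^σ φ_μ/L)`, the symbol of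
the boost-gauge hopping `Σ_μ (e^{i(-1)^σ φ_μ/L} c†_{xσ} c_{x+e_μ,σ} + h.c.)` on the plane wave `χ_k`.
Karakuzu–Seki–Sorella (2018) Sec. II D. [folklore] -/
def twistHopSymbol (φ : Fin d → ℝ) (k : TorusSite d L) (σ : Fin 2) : ℝ :=
  2 * ∑ μ : Fin d, Real.cos (latticeMomentum L k μ + (-1 : ℝ) ^ (σ : ℕ) * φ μ / L)

/-- The consistently twisted pair symbol `ĝ_φ(k) = 2 Σ_μ (-1)^μ cos(p_μ + φ_μ/L)` (in `d = 2`: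
`2(cos(p₀ + φ₀/L) - cos(p₁ + φ₁/L))`, the `d_{x²-y²}` form factor at the boosted momentum).
Scalapino (1995) §2. [folklore] -/
def twistPairSymbol (φ : Fin d → ℝ) (k : TorusSite d L) : ℝ :=
  2 * ∑ μ : Fin d, (-1 : ℝ) ^ (μ : ℕ) * Real.cos (latticeMomentum L k μ + φ μ / L)

/-- The twisted level energy measured from the chemical potential,
`ξ_k(φ) = -2 Σ_μ cos(2πk_μ/L + φ_μ/L) - μ₀ = ε(k + φ/L) - μ₀`. [folklore] -/
def twistXi (μ₀ : ℝ) (φ : Fin d → ℝ) (k : TorusSite d L) : ℝ :=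
  -2 * ∑ μ : Fin d, Real.cos (latticeMomentum L k μ + φ μ / L) - μ₀

/-- The Nambu symbol `z_k(φ) = ξ_k(φ) + i h ĝ_k(φ)`: the Nambu block at momentum `k` is the real
symmetric matrix `[[ξ, hĝ], [hĝ, -ξ]]`, of energies `±|z_k|`. de Gennes (1966) Ch. 5. [folklore] -/
def twistNambuZ (μ₀ h : ℝ) (φ : Fin d → ℝ) (k : TorusSite d L) : ℂ :=
  ((twistXi L μ₀ φ k : ℝ) : ℂ) + ((h * twistPairSymbol L φ k : ℝ) : ℂ) * Complex.I

variable {L} in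
/-- `ξ_k = -t_↑(k) - μ₀`. [folklore] -/
theorem twistXi_eq (μ₀ : ℝ) (φ : Fin d → ℝ) (k : TorusSite d L) :
    twistXi L μ₀ φ k = -twistHopSymbol L φ k 0 - μ₀ := by
  simp [twistXi, twistHopSymbol, neg_mul]

/-! ### The Nambu block and its eigenvectors -/

variable [NeZero L]

/-- The Nambu quadratic form at momentum `k` with real coefficients `(a, b)`:
`Q_k(a,b) = a (n_{k↑} - n_{k↓}) + b (c†_{k↓} c_{k↑} + c†_{k↑} c_{k↓})`, the second quantisation of the
traceless real symmetric matrix `[[a, b], [b, -a]]` on the two Bloch modes `(k↑), (k↓)`.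
de Gennes (1966) Ch. 5 (Nambu form of the BdG Hamiltonian). [folklore] -/
def nambuQuad (k : TorusSite d L) (a b : ℝ) :
    Matrix (Finset (Orb (FermionTorus d L))) (Finset (Orb (FermionTorus d L))) ℂ :=
  (a : ℂ) • (momentumNumber k 0 - momentumNumber k 1) +
    (b : ℂ) • (momentumCreation k 1 * momentumAnnihilation k 0 +
      momentumCreation k 0 * momentumAnnihilation k 1)

/-- The unit lower eigenvector of `S = [[a, b], [b, -a]]`, encoded as a unit complex number
`p = x + iy ↔ (x, y) ∈ ℝ²`, for `z = a + ib`: `S` acts as `p ↦ z p̄`, and `p₋ = i√z/|√z|` (principal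
square root) satisfies `z p̄₋ = -|z| p₋`, i.e. `|z| p₋² = -z` (`norm_mul_nambuLower_sq`); the upper
eigenvector is `-i p₋ = √z/|√z|`. Junk value `1` at `z = 0` (there `S = 0` and every unit vector is
an eigenvector). de Gennes (1966) Ch. 5 (Bogoliubov angles `u_k, v_k`). [folklore] -/
def nambuLower (z : ℂ) : ℂ :=
  if z = 0 then 1 else Complex.I * z ^ (2⁻¹ : ℂ) / ((‖z ^ (2⁻¹ : ℂ)‖ : ℝ) : ℂ)

/-- `p₋(z)` is a unit vector. [folklore] -/
theorem norm_nambuLower (z : ℂ) : ‖nambuLower z‖ = 1 := by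
  unfold nambuLower
  split_ifs with hz
  · simp
  · have hs : z ^ (2⁻¹ : ℂ) ≠ 0 := by
      intro h0
      apply hz
      rw [← Complex.cpow_ofNat_inv_pow z 2, h0]; ring
    have hn : ‖z ^ (2⁻¹ : ℂ)‖ ≠ 0 := norm_ne_zero_iff.mpr hs
    rw [norm_div, norm_mul, Complex.norm_I, one_mul, Complex.norm_real, Real.norm_eq_abs,
      abs_of_nonneg (norm_nonneg _), div_self hn]

/-- **The eigenvector relation** `|z| p₋(z)² = -z` (equivalently `z p̄₋ = -|z| p₋`). [folklore] -/
theorem norm_mul_nambuLower_sq (z : ℂ) : (‖z‖ : ℂ) * nambuLower z ^ 2 = -z := by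
  unfold nambuLower
  split_ifs with hz
  · simp [hz]
  · have hs : z ^ (2⁻¹ : ℂ) ≠ 0 := by
      intro h0
      apply hz
      rw [← Complex.cpow_ofNat_inv_pow z 2, h0]; ring
    have hn : (‖z ^ (2⁻¹ : ℂ)‖ : ℂ) ≠ 0 := by
      rw [Ne, Complex.ofReal_eq_zero]; exact norm_ne_zero_iff.mpr hs
    have hz' : (‖z‖ : ℂ) ≠ 0 := by
      rw [Ne, Complex.ofReal_eq_zero, norm_eq_zero]; exact hz
    have hns : ‖z ^ (2⁻¹ : ℂ)‖ ^ 2 = ‖z‖ := by rw [← norm_pow, Complex.cpow_ofNat_inv_pow]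
    rw [div_pow, mul_pow, Complex.I_sq, Complex.cpow_ofNat_inv_pow, ← Complex.ofReal_pow, hns]
    field_simp

/-- The Nambu mode of momentum `k` with (real) spinor `p = x + iy ↔ (x, y)`:
`u = L^{-d/2} (x χ_k ⊗ ↑ + y χ_k ⊗ ↓)` as a one-particle function on the orbitals of the torus, so
that `c(u) = x c_{k↑} + y c_{k↓}`. de Gennes (1966) Ch. 5. [folklore] -/
def nambuMode (k : TorusSite d L) (p : ℂ) : Orb (FermionTorus d L) → ℂ :=
  fun o => torusFourierWeight d L * ((p.re : ℂ) * planeWave k 0 o + (p.im : ℂ) * planeWave k 1 o)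

/-! ### The Bogoliubov modes of the twisted sourced family -/

/-- The Bogoliubov spinor of the mode labelled `(k, σ)`: `σ = 1 ↦ p₋(z_k)` (lower band, energy
`-|z_k|`), `σ = 0 ↦ -i p₋(z_k)` (upper band, energy `+|z_k|`). [folklore] -/
def bdgSpinor (μ₀ h : ℝ) (φ : Fin d → ℝ) (k : TorusSite d L) (σ : Fin 2) : ℂ :=
  if σ = 0 then -Complex.I * nambuLower (twistNambuZ L μ₀ h φ k)
  else nambuLower (twistNambuZ L μ₀ h φ k)

/-- **The Bogoliubov mode matrix** of the `U = 0` sourced spin-twisted family: the one-body matrix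
on the orbitals of the torus whose column at the label `(x, σ)` is the Nambu mode of momentum
`k = x̄` and spinor `bdgSpinor L μ₀ h φ k σ` (upper band at `σ = 0`, lower band at `σ = 1`); it is
unitary and `Γ(bdgModeMatrix)` diagonalises `W H(φ) Wᴴ`. de Gennes (1966) Ch. 5. [folklore] -/
def bdgModeMatrix (μ₀ h : ℝ) (φ : Fin d → ℝ) :
    Matrix (Orb (FermionTorus d L)) (Orb (FermionTorus d L)) ℂ :=
  Matrix.of fun o o' => nambuMode L (FermionTorus.toTorusSite (ofLex o').1)
    (bdgSpinor L μ₀ h φ (FermionTorus.toTorusSite (ofLex o').1) (ofLex o').2) o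

/-- The Bogoliubov mode energies: `+|z_{x̄}|` at the label `(x, ↑)`, `-|z_{x̄}|` at `(x, ↓)`.
de Gennes (1966) Ch. 5. [folklore] -/
def bdgModeEnergy (μ₀ h : ℝ) (φ : Fin d → ℝ) (o' : Orb (FermionTorus d L)) : ℝ :=
  if (ofLex o').2 = 0 then ‖twistNambuZ L μ₀ h φ (FermionTorus.toTorusSite (ofLex o').1)‖
  else -‖twistNambuZ L μ₀ h φ (FermionTorus.toTorusSite (ofLex o').1)‖

variable {L} in
/-- The column of the mode matrix at the label `(x, σ)` is the Nambu mode of momentum `x̄` and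
spinor `bdgSpinor … x̄ σ`. [folklore] -/
theorem bdgModeMatrix_col (μ₀ h : ℝ) (φ : Fin d → ℝ) (x : FermionTorus d L) (σ : Fin 2) :
    (fun o => bdgModeMatrix L μ₀ h φ o (orb x σ)) =
      nambuMode L x.toTorusSite (bdgSpinor L μ₀ h φ x.toTorusSite σ) := rfl

/-- **The diagonalising unitary** `V = Γ(U)ᴴ W` of the `U = 0` sourced spin-twisted family on the
two-dimensional torus: `U = bdgModeMatrix`, `W = partialParticleHole D↓` Lieb's partial
particle–hole transformation on the spin-down orbitals. Lieb (1989), proof of Thm 2;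
Bratteli–Robinson II §5.2.1. [folklore] -/
def bdgV (μ₀ h : ℝ) (φ : Fin 2 → ℝ) :
    Matrix (Finset (Orb (FermionTorus 2 L))) (Finset (Orb (FermionTorus 2 L))) ℂ :=
  (Gamma (bdgModeMatrix L μ₀ h φ))ᴴ *
    partialParticleHole (spinDownOrbitals : Finset (Orb (FermionTorus 2 L)))

end Literature.MathematicalPhysics.QuantumLattice
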